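import Literature.NumberTheory.Kottwitz1992.HermitianSymmetricSpaces
import Literature.NumberTheory.Kottwitz1992.InvolutionsLemma23bHolds
import Literature.NumberTheory.Kottwitz1992.InvolutionsLemma26bHolds
import HarnessLib

/-!
# [Kottwitz1992, Lemma 4.2 (first statement) p. 387] Isomorphic `B ⊗_ℝ ℂ`-structures give isomorphic skew-Hermitian modules —
# DISCHARGED: `Kottwitz1992_4_2_iso_holds`

Kernel-lane companion of the statement carpet ★ `Literature/NumberTheory/Kottwitz1992/HermitianSymmetricSpaces.lean` (squad TK, TK-t02;
builds on the §2 carpet ★ `Involutions` and its discharges ★ `InvolutionsLemma23bHolds` (Lemma 2.3 (2)) and ★ `InvolutionsLemma26bHolds`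
(Lemma 2.6 (2))): the named fact ★ `HermitianSymmetricSpaces.Kottwitz1992_4_2_iso` — «Let `(B, *, V, ⟨·,·⟩, h)` be as before and assume
that `⟨·,·⟩′` and `h′` satisfy the same conditions as `⟨·,·⟩` and `h`.  Assume further that the two `B ⊗_ℝ ℂ`-module structures on `V`
obtained from `h` and `h′` are isomorphic.  Then `(V, ⟨·,·⟩, h)` and `(V, ⟨·,·⟩′, h′)` are isomorphic as skew-Hermitian `B ⊗_ℝ ℂ`-modules» —
is PROVED here as `theorem Kottwitz1992_4_2_iso_holds : Kottwitz1992_4_2_iso`.  THEOREMS ONLY (no definition, no named fact, no `sorry`,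
no instance, no notation); cell hodgecm-mathlib, seat B-typ04 (g30); net debt −1.

R. E. Kottwitz, *Points on some Shimura varieties over finite fields*, J. Amer. Math. Soc. 5 (1992), Lemma 4.2 p. 387, proof p. 387 L45 –
p. 388 L5 (held `paper:doi-10-2307-2152772`, p0015–p0016).  THE PRINTED PROOF: «First we prove the first statement.  The positive definite
form `⟨v, h(i)w⟩` is `B ⊗_ℝ ℂ`-Hermitian for the positive involution on `B ⊗_ℝ ℂ` obtained by taking the tensor product of `*` on `B` and
complex conjugation on `ℂ`, where we have used `h` to regard `V` as `B ⊗_ℝ ℂ`-module.  We have the analogous assertion for `⟨·,·⟩′` and `h′`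
as well.  By Lemma 2.6 the two Hermitian `B ⊗_ℝ ℂ`-modules we get from `⟨·,·⟩, h` and `⟨·,·⟩′, h′` are isomorphic.  Concretely this says that
there exists `c ∈ C^×` such that `h′ = Int(c) ∘ h` and `⟨v, h(i)w⟩ = ⟨cv, h′(i)cw⟩′` for all `v, w ∈ V`.  It follows that `⟨v, w⟩ =
⟨cv, cw⟩′` for all `v, w ∈ V`, which means that `c` is an isomorphism from the skew-Hermitian `B`-module `(V, ⟨·,·⟩, h)` to
`(V, ⟨·,·⟩′, h′)`.»  Followed here step by step, in the tree's currency (★ `SkewHermitianForm`, ★ `HodgeMap`, ★ `IsPositiveFor`; the §2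
notions ★ `Involutions.IsAlgebraWithInvolution`, ★ `IsPositiveInvolution`, ★ `IsPosDefHermitianForm`):
* §1 (universe bookkeeping, no mathematical content) the letters of §2 are typed for an algebra and modules in ONE universe, while the fact
  quantifies `B : Type u`, `V : Type v`; we therefore run the printed argument on the lifted copies `ULift B`, `ULift ℂ`, `ULift V` in
  `Type (max u v)`, transporting involutions, positivity (`tr_{ULift R/ℝ}(y) = tr_{R/ℝ}(y.down)`) and the standing hypothesis;
* §2 «the positive involution on `B ⊗_ℝ ℂ` obtained by taking the tensor product of `*` on `B` and complex conjugation on `ℂ`»: complex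
  conjugation is a positive involution of `ℂ` (`tr_{ℂ/ℝ}(z z̄) = 2|z|²`), so ★ Lemma 2.3 (2) applies; and a finite-dimensional `ℝ`-algebra
  with a positive involution is semisimple (Jacobson radical argument — the step the print leaves implicit when it applies Lemma 2.6 to
  `B ⊗_ℝ ℂ`), so `B ⊗_ℝ ℂ` satisfies the standing hypothesis of §2;
* §3 «where we have used `h` to regard `V` as `B ⊗_ℝ ℂ`-module»: the action through the `ℝ`-algebra map `B ⊗_ℝ ℂ → End_ℝ(V)`,
  `b ⊗ z ↦ ρ(b) h(z)` (Mathlib `Algebra.TensorProduct.lift`, the factors commute by `HodgeMap.comm`);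
* §4 the two positive definite Hermitian forms on this ONE module: `Φ = ⟨v, h(i)w⟩` (printed) and — realising «the analogous assertion for
  `⟨·,·⟩′` and `h′`» on the same module through the given module isomorphism `f` — `Φ′ = ⟨fv, h′(i)fw⟩′`;
* §5 «By Lemma 2.6 …»: ★ `Kottwitz1992_2_6_2_iso_iff_holds` gives a `B ⊗_ℝ ℂ`-linear `e` with `Φ′(ev, ew) = Φ(v, w)`; `g = f ∘ e` commutes
  with `ρ(B)`, intertwines `h` and `h′`, and «it follows that `⟨v, w⟩ = ⟨gv, gw⟩′`» by substituting `w ↦ −h(i)w` (`h(i)² = −1`).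
HONEST LABEL: HC_CM is proved only modulo the 7 printed citations (2 remaining: hLiu418, h413) until rung 0 closes; this file adds no citation
debt (0 facts, 0 sorry) and discharges 1 named fact of ★ `HermitianSymmetricSpaces`.

## References
* [Kottwitz1992] R. E. Kottwitz, Points on some Shimura varieties over finite fields, J. Amer. Math. Soc. 5 (1992) 373–444, Lemma 4.2 and
  its proof, pp. 387–388; Lemma 2.3 (2) p. 380, Lemma 2.6 (2) p. 380, the data of p. 387.
-/

noncomputable section

namespace Literature.NumberTheory.Kottwitz1992.HermitianSymmetricSpaces

open TensorProduct
open scoped ComplexConjugate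
open Literature.NumberTheory.Kottwitz1992.Involutions
open Literature.NumberTheory.Automorphic (leftMulTrace leftMulTrace_apply)

universe u v w

/-! ## §1–§2 Preliminaries: semisimplicity from positivity, `ULift` transport, complex conjugation -/

section Prelim

variable {R : Type u} [Ring R] [Algebra ℝ R]

/-- A finite-dimensional `ℝ`-algebra with a positive involution `σ` is semisimple: its Jacobson radical `J` is nilpotent (Artinian ring),
and for `u ∈ J` the element `σ(u) u ∈ J` is nilpotent, so `tr(σ(u) σ(u)*) = tr(σ(u) u) = 0` forces `u = 0`. (The step the print leaves
implicit when Lemma 2.6 is applied to `B ⊗_ℝ ℂ`.) [cite: Kottwitz1992, Lemma 4.2 (p. 387)] -/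
private theorem isSemisimpleRing_of_isPositiveInvolution [FiniteDimensional ℝ R] {σ : R →ₗ[ℝ] R} (hσ : IsPositiveInvolution R σ) :
    IsSemisimpleRing R := by
  haveI : IsArtinianRing R := IsArtinianRing.of_finite ℝ R
  rw [IsArtinianRing.isSemisimpleRing_iff_jacobson, eq_bot_iff]
  intro u hu
  rw [Ideal.mem_bot]
  obtain ⟨n, hn⟩ := IsSemiprimaryRing.isNilpotent (R := R)
  have hv : σ u * u ∈ Ring.jacobson R := Ideal.mul_mem_left _ _ hu
  have hvn : (σ u * u) ^ n = 0 := by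
    have h := Ideal.pow_mem_pow hv n
    rw [hn, Ideal.zero_eq_bot, Ideal.mem_bot] at h
    exact h
  have htr : leftMulTrace ℝ R (σ u * u) = 0 := by
    have h1 : IsNilpotent (Algebra.lmul ℝ R (σ u * u)) := ⟨n, by rw [← map_pow, hvn, map_zero]⟩
    rw [leftMulTrace_apply]
    exact (LinearMap.isNilpotent_trace_of_isNilpotent h1).eq_zero
  by_contra hu0
  have hσu : σ u ≠ 0 := fun h => hu0 (by rw [← hσ.apply_apply u, h, map_zero])
  have hpos := hσ.trace_mul_self_pos (σ u) hσu
  rw [hσ.apply_apply, htr] at hpos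
  exact lt_irrefl 0 hpos

/-- `tr_{ULift R/ℝ}(y) = tr_{R/ℝ}(y.down)` (left multiplication on `ULift R` is conjugate to that on `R` along `down`). [folklore] -/
private theorem leftMulTrace_ulift (y : ULift.{w} R) : leftMulTrace ℝ (ULift.{w} R) y = leftMulTrace ℝ R y.down := by
  rw [leftMulTrace_apply, leftMulTrace_apply]
  have h : (Algebra.lmul ℝ (ULift.{w} R) y : ULift.{w} R →ₗ[ℝ] ULift.{w} R) =
      (ULift.moduleEquiv (R := ℝ) (M := R)).symm.conj (Algebra.lmul ℝ R y.down) := by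
    apply LinearMap.ext
    intro z
    rfl
  rw [h, LinearMap.trace_conj']

/-- An involution of `R` with positive trace form, transported to `ULift R`, is a positive involution. (Universe bookkeeping.) [folklore] -/
private theorem isPositiveInvolution_ulift {ι : R →ₗ[ℝ] R} (hι : IsInvolution ℝ R ι)
    (hpos : ∀ x : R, x ≠ 0 → 0 < leftMulTrace ℝ R (x * ι x)) :
    IsPositiveInvolution (ULift.{w} R)
      ((ULift.moduleEquiv (R := ℝ) (M := R)).symm.toLinearMap ∘ₗ ι ∘ₗ (ULift.moduleEquiv (R := ℝ) (M := R)).toLinearMap) := by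
  refine ⟨⟨fun x y => ?_, fun x => ?_⟩, fun x hx => ?_⟩
  · apply ULift.ext
    show ι (x.down * y.down) = ι y.down * ι x.down
    exact hι.map_mul _ _
  · apply ULift.ext
    show ι (ι x.down) = x.down
    exact hι.apply_apply _
  · rw [leftMulTrace_ulift]
    exact hpos x.down fun h => hx (ULift.ext _ _ h)

/-- The standing hypothesis of §2 passes to `ULift R`. (Universe bookkeeping.) [folklore] -/
private theorem isAlgebraWithInvolution_ulift [FiniteDimensional ℝ R] [IsSemisimpleRing R] {ι : R →ₗ[ℝ] R} (hι : IsInvolution ℝ R ι) :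
    IsAlgebraWithInvolution (ULift.{w} R)
      ((ULift.moduleEquiv (R := ℝ) (M := R)).symm.toLinearMap ∘ₗ ι ∘ₗ (ULift.moduleEquiv (R := ℝ) (M := R)).toLinearMap) := by
  refine ⟨inferInstance, (ULift.ringEquiv (R := R)).symm.isSemisimpleRing, ⟨fun x y => ?_, fun x => ?_⟩⟩
  · apply ULift.ext
    show ι (x.down * y.down) = ι y.down * ι x.down
    exact hι.map_mul _ _
  · apply ULift.ext
    show ι (ι x.down) = x.down
    exact hι.apply_apply _

/-- «complex conjugation on `ℂ`» is a positive involution: `tr_{ℂ/ℝ}(z z̄) = 2 |z|² > 0`. [cite: Kottwitz1992, Lemma 4.2 (p. 387)] -/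
private theorem conj_trace_pos (z : ℂ) (hz : z ≠ 0) : 0 < leftMulTrace ℝ ℂ (z * conj z) := by
  have h : leftMulTrace ℝ ℂ (z * conj z) = Algebra.trace ℝ ℂ (z * conj z) := rfl
  rw [h, Algebra.trace_complex_apply, Complex.mul_conj, Complex.ofReal_re]
  exact mul_pos two_pos (Complex.normSq_pos.mpr hz)

end Prelim

/-! ## §3–§5 Lemma 4.2, first statement -/

/-- **Lemma 4.2 (first statement), PROVED**: ★ `Kottwitz1992_4_2_iso` holds — if `(⟨·,·⟩, h)` and `(⟨·,·⟩′, h′)` both satisfy the conditions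
of p. 387 and the two `B ⊗_ℝ ℂ`-module structures on `V` are isomorphic, then some `B ⊗_ℝ ℂ`-linear automorphism of `V` carries `⟨·,·⟩` to
`⟨·,·⟩′`: the forms `⟨v, h(i)w⟩` and `⟨fv, h′(i)fw⟩′` are positive definite Hermitian on the `B ⊗_ℝ ℂ`-module `(V, h)` for the positive
involution `* ⊗ conj` (Lemma 2.3 (2)); Lemma 2.6 (2) gives a module automorphism `e` matching them; `g = f ∘ e`, and `⟨gv, gw⟩′ = ⟨v, w⟩`
follows with `w ↦ −h(i)w`. [cite: Kottwitz1992, Lemma 4.2 (p. 387)] -/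
theorem Kottwitz1992_4_2_iso_holds : Kottwitz1992_4_2_iso.{u, v} := by
  intro B _ _ _ _ _ _ V _ _ _ ρ ψ ψ' η η' hposB hiso
  obtain ⟨f, hfρ, hfh⟩ := hiso
  /- §2 the involutions `*` on `B` and `conj` on `ℂ` as `ℝ`-linear maps, and their lifts to `Type (max u v)` -/
  obtain ⟨sB, hsB⟩ : ∃ s : B →ₗ[ℝ] B, ∀ x : B, s x = star x :=
    ⟨{ toFun := star, map_add' := star_add, map_smul' := fun r x => by rw [star_smul, star_trivial]; rfl }, fun _ => rfl⟩
  obtain ⟨cC, hcC⟩ : ∃ c : ℂ →ₗ[ℝ] ℂ, ∀ z : ℂ, c z = conj z := ⟨Complex.conjAe.toLinearMap, fun _ => rfl⟩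
  have hsBi : IsInvolution ℝ B sB :=
    ⟨fun x y => by rw [hsB, hsB, hsB, star_mul], fun x => by rw [hsB, hsB, star_star]⟩
  have hcCi : IsInvolution ℝ ℂ cC :=
    ⟨fun x y => by rw [hcC, hcC, hcC, map_mul, mul_comm], fun x => by rw [hcC, hcC, Complex.conj_conj]⟩
  have hposB' : ∀ x : B, x ≠ 0 → 0 < leftMulTrace ℝ B (x * sB x) := fun x hx => by
    rw [hsB, leftMulTrace_apply]
    exact hposB x hx
  have hposC' : ∀ z : ℂ, z ≠ 0 → 0 < leftMulTrace ℝ ℂ (z * cC z) := fun z hz => by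
    rw [hcC]; exact conj_trace_pos z hz
  -- the lifted algebras `B₁ = ULift B`, `C₁ = ULift ℂ` in `Type (max u v)`, with involutions `s₁`, `c₁`
  obtain ⟨s₁, hs₁⟩ : ∃ s₁ : ULift.{v} B →ₗ[ℝ] ULift.{v} B,
      s₁ = (ULift.moduleEquiv (R := ℝ) (M := B)).symm.toLinearMap ∘ₗ sB ∘ₗ (ULift.moduleEquiv (R := ℝ) (M := B)).toLinearMap :=
    ⟨_, rfl⟩
  obtain ⟨c₁, hc₁⟩ : ∃ c₁ : ULift.{max u v} ℂ →ₗ[ℝ] ULift.{max u v} ℂ,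
      c₁ = (ULift.moduleEquiv (R := ℝ) (M := ℂ)).symm.toLinearMap ∘ₗ cC ∘ₗ (ULift.moduleEquiv (R := ℝ) (M := ℂ)).toLinearMap :=
    ⟨_, rfl⟩
  have hs₁d : ∀ x : ULift.{v} B, (s₁ x).down = star x.down := fun x => by rw [hs₁]; exact hsB _
  have hc₁d : ∀ z : ULift.{max u v} ℂ, (c₁ z).down = conj z.down := fun z => by rw [hc₁]; exact hcC _
  have hB₁ : IsAlgebraWithInvolution (ULift.{v} B) s₁ := hs₁ ▸ isAlgebraWithInvolution_ulift hsBi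
  have hposB₁ : IsPositiveInvolution (ULift.{v} B) s₁ := hs₁ ▸ isPositiveInvolution_ulift hsBi hposB'
  haveI : IsSemisimpleRing ℂ := inferInstance
  have hC₁ : IsAlgebraWithInvolution (ULift.{max u v} ℂ) c₁ := hc₁ ▸ isAlgebraWithInvolution_ulift hcCi
  have hposC₁ : IsPositiveInvolution (ULift.{max u v} ℂ) c₁ := hc₁ ▸ isPositiveInvolution_ulift hcCi hposC'
  /- §2 «the positive involution on `B ⊗_ℝ ℂ` obtained by taking the tensor product of `*` on `B` and complex conjugation on `ℂ`»
  (Lemma 2.3 (2)); the algebra `A = B ⊗_ℝ ℂ` then satisfies the standing hypothesis of §2 -/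
  have hposA := (Kottwitz1992_2_3_2_tensor_prod_holds (ULift.{v} B) s₁ (ULift.{max u v} ℂ) c₁ hB₁ hC₁ hposB₁ hposC₁).1
  have hA : IsAlgebraWithInvolution (ULift.{v} B ⊗[ℝ] ULift.{max u v} ℂ) (TensorProduct.map s₁ c₁) :=
    ⟨inferInstance, isSemisimpleRing_of_isPositiveInvolution hposA, hposA.toIsInvolution⟩
  /- §3 «where we have used `h` to regard `V` as `B ⊗_ℝ ℂ`-module»: `(b ⊗ z) · v = ρ(b) h(z) v`, on `V₁ = ULift V` -/
  obtain ⟨mV, hmV⟩ : ∃ mV : ULift.{u} V ≃ₗ[ℝ] V, ∀ x, mV x = x.down := ⟨ULift.moduleEquiv, fun _ => rfl⟩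
  have hmVs : ∀ v : V, mV.symm v = ULift.up v := fun v => mV.injective (by rw [LinearEquiv.apply_symm_apply, hmV])
  let eEnd : Module.End ℝ V ≃ₐ[ℝ] Module.End ℝ (ULift.{u} V) := mV.symm.conjAlgEquiv ℝ
  have heEnd : ∀ (T : Module.End ℝ V) (x : ULift.{u} V), eEnd T x = ULift.up (T x.down) := fun T x => by
    show mV.symm (T (mV.symm.symm x)) = _
    rw [LinearEquiv.symm_symm, hmV, hmVs]
  let ρ₁ : ULift.{v} B →ₐ[ℝ] Module.End ℝ (ULift.{u} V) :=
    eEnd.toAlgHom.comp (ρ.comp (ULift.algEquiv (R := ℝ) (A := B)).toAlgHom)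
  let h₁ : ULift.{max u v} ℂ →ₐ[ℝ] Module.End ℝ (ULift.{u} V) :=
    eEnd.toAlgHom.comp (η.h.comp (ULift.algEquiv (R := ℝ) (A := ℂ)).toAlgHom)
  have hρ₁ : ∀ (b : ULift.{v} B) (x : ULift.{u} V), ρ₁ b x = ULift.up (ρ b.down x.down) := fun b x => heEnd _ _
  have hh₁ : ∀ (z : ULift.{max u v} ℂ) (x : ULift.{u} V), h₁ z x = ULift.up (η.h z.down x.down) := fun z x => heEnd _ _
  have hcomm : ∀ (b : ULift.{v} B) (z : ULift.{max u v} ℂ), Commute (ρ₁ b) (h₁ z) := fun b z => by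
    refine LinearMap.ext fun x => ?_
    show ρ₁ b (h₁ z x) = h₁ z (ρ₁ b x)
    rw [hh₁, hρ₁, hh₁, hρ₁]
    congr 1
    show (ρ b.down * η.h z.down) x.down = (η.h z.down * ρ b.down) x.down
    rw [η.comm]
  let φ : ULift.{v} B ⊗[ℝ] ULift.{max u v} ℂ →ₐ[ℝ] Module.End ℝ (ULift.{u} V) := Algebra.TensorProduct.lift ρ₁ h₁ hcomm
  letI : Module (ULift.{v} B ⊗[ℝ] ULift.{max u v} ℂ) (ULift.{u} V) := Module.compHom (ULift.{u} V) φ.toRingHom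
  have hsmA : ∀ (a : ULift.{v} B ⊗[ℝ] ULift.{max u v} ℂ) (x : ULift.{u} V), a • x = φ a x := fun _ _ => rfl
  have hsm : ∀ (b : ULift.{v} B) (z : ULift.{max u v} ℂ) (x : ULift.{u} V),
      (b ⊗ₜ[ℝ] z) • x = ULift.up (ρ b.down (η.h z.down x.down)) := fun b z x => by
    rw [hsmA, Algebra.TensorProduct.lift_tmul, Module.End.mul_apply, hh₁, hρ₁]
  haveI : IsScalarTower ℝ (ULift.{v} B ⊗[ℝ] ULift.{max u v} ℂ) (ULift.{u} V) :=
    ⟨fun r a x => by rw [hsmA, hsmA, map_smul, LinearMap.smul_apply]⟩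
  haveI : Module.Finite (ULift.{v} B ⊗[ℝ] ULift.{max u v} ℂ) (ULift.{u} V) := Module.Finite.of_restrictScalars_finite ℝ _ _
  /- commuting relations in `End_ℝ(V)` («`h : ℂ → End_B(V)`», and `ℂ` is commutative) -/
  have hzρ : ∀ (z : ℂ) (b : B) (w : V), η.h z (ρ b w) = ρ b (η.h z w) := fun z b w => by
    show (η.h z * ρ b) w = (ρ b * η.h z) w
    rw [η.comm]
  have hzρ' : ∀ (z : ℂ) (b : B) (w : V), η'.h z (ρ b w) = ρ b (η'.h z w) := fun z b w => by
    show (η'.h z * ρ b) w = (ρ b * η'.h z) w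
    rw [η'.comm]
  have hhh : ∀ (z z' : ℂ) (w : V), η.h z (η.h z' w) = η.h z' (η.h z w) := fun z z' w => by
    show (η.h z * η.h z') w = (η.h z' * η.h z) w
    rw [← map_mul, ← map_mul, mul_comm]
  have hhh' : ∀ (z z' : ℂ) (w : V), η'.h z (η'.h z' w) = η'.h z' (η'.h z w) := fun z z' w => by
    show (η'.h z * η'.h z') w = (η'.h z' * η'.h z) w
    rw [← map_mul, ← map_mul, mul_comm]
  have hskew : ∀ a b : V, ψ.form b a = -ψ.form a b := fun a b => by
    have h0 := ψ.isAlt (a + b)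
    simp only [map_add, LinearMap.add_apply, ψ.isAlt, zero_add, add_zero] at h0
    linarith
  have hskew' : ∀ a b : V, ψ'.form b a = -ψ'.form a b := fun a b => by
    have h0 := ψ'.isAlt (a + b)
    simp only [map_add, LinearMap.add_apply, ψ'.isAlt, zero_add, add_zero] at h0
    linarith
  /- §4 the two positive definite Hermitian forms on the ONE module `(V₁, h)`: `Φ = ⟨v, h(i)w⟩` and `Φ′ = ⟨fv, h′(i)fw⟩′` -/
  obtain ⟨Φ, hΦ⟩ : ∃ Φ : LinearMap.BilinForm ℝ (ULift.{u} V), ∀ x y : ULift.{u} V,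
      Φ x y = ψ.form x.down (η.h Complex.I y.down) :=
    ⟨ψ.form.compl₁₂ mV.toLinearMap ((η.h Complex.I) ∘ₗ mV.toLinearMap), fun x y => by
      simp only [LinearMap.compl₁₂_apply, LinearMap.coe_comp, Function.comp_apply, LinearEquiv.coe_coe, hmV]⟩
  obtain ⟨Φ', hΦ'⟩ : ∃ Φ' : LinearMap.BilinForm ℝ (ULift.{u} V), ∀ x y : ULift.{u} V,
      Φ' x y = ψ'.form (f x.down) (η'.h Complex.I (f y.down)) :=
    ⟨ψ'.form.compl₁₂ (f.toLinearMap ∘ₗ mV.toLinearMap) ((η'.h Complex.I) ∘ₗ f.toLinearMap ∘ₗ mV.toLinearMap), fun x y => by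
      simp only [LinearMap.compl₁₂_apply, LinearMap.coe_comp, Function.comp_apply, LinearEquiv.coe_coe, hmV]⟩
  /- «The positive definite form `⟨v, h(i)w⟩` is `B ⊗_ℝ ℂ`-Hermitian for the positive involution … » -/
  have hΦP : IsPosDefHermitianForm (ULift.{v} B ⊗[ℝ] ULift.{max u v} ℂ) (ULift.{u} V) (TensorProduct.map s₁ c₁) Φ := by
    refine ⟨⟨fun x y => ?_, fun a x y => ?_⟩, fun x hx => ?_⟩
    · rw [hΦ, hΦ, hskew (η.h Complex.I x.down) y.down, η.adjoint, Complex.conj_I, map_neg η.h, LinearMap.neg_apply,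
        map_neg (ψ.form x.down), neg_neg]
    · induction a using TensorProduct.induction_on with
      | zero =>
        rw [← TensorProduct.zero_tmul (ULift.{v} B) (0 : ULift.{max u v} ℂ), TensorProduct.map_tmul, hsm, hsm, hΦ, hΦ]
        simp
      | tmul b z =>
        rw [TensorProduct.map_tmul, hsm, hsm, hΦ, hΦ, hs₁d, hc₁d]
        show ψ.form (ρ b.down (η.h z.down x.down)) (η.h Complex.I y.down) =
          ψ.form x.down (η.h Complex.I (ρ (star b.down) (η.h (conj z.down) y.down)))
        rw [ψ.skew, η.adjoint, hzρ, hzρ, hhh]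
      | add a₁ a₂ ha₁ ha₂ => simp only [add_smul, map_add, LinearMap.add_apply, ha₁, ha₂]
    · rw [hΦ]
      exact η.pos x.down fun h0 => hx (ULift.ext x 0 h0)
  /- «We have the analogous assertion for `⟨·,·⟩′` and `h′` as well» (transported along `f`) -/
  have hΦ'P : IsPosDefHermitianForm (ULift.{v} B ⊗[ℝ] ULift.{max u v} ℂ) (ULift.{u} V) (TensorProduct.map s₁ c₁) Φ' := by
    refine ⟨⟨fun x y => ?_, fun a x y => ?_⟩, fun x hx => ?_⟩
    · rw [hΦ', hΦ', hskew' (η'.h Complex.I (f x.down)) (f y.down), η'.adjoint, Complex.conj_I, map_neg η'.h,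
        LinearMap.neg_apply, map_neg (ψ'.form (f x.down)), neg_neg]
    · induction a using TensorProduct.induction_on with
      | zero =>
        rw [← TensorProduct.zero_tmul (ULift.{v} B) (0 : ULift.{max u v} ℂ), TensorProduct.map_tmul, hsm, hsm, hΦ', hΦ']
        simp
      | tmul b z =>
        rw [TensorProduct.map_tmul, hsm, hsm, hΦ', hΦ', hs₁d, hc₁d]
        show ψ'.form (f (ρ b.down (η.h z.down x.down))) (η'.h Complex.I (f y.down)) =
          ψ'.form (f x.down) (η'.h Complex.I (f (ρ (star b.down) (η.h (conj z.down) y.down))))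
        simp only [hfρ, hfh]
        rw [ψ'.skew, η'.adjoint, hzρ', hzρ', hhh']
      | add a₁ a₂ ha₁ ha₂ => simp only [add_smul, map_add, LinearMap.add_apply, ha₁, ha₂]
    · rw [hΦ']
      exact η'.pos (f x.down) fun h0 => hx (ULift.ext x 0 ((LinearEquiv.map_eq_zero_iff f).mp h0))
  /- §5 «By Lemma 2.6 the two Hermitian `B ⊗_ℝ ℂ`-modules … are isomorphic» -/
  obtain ⟨e, he⟩ := (Kottwitz1992_2_6_2_iso_iff_holds (TensorProduct.map s₁ c₁) hA hposA (ULift.{u} V) (ULift.{u} V) Φ Φ'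
    hΦP hΦ'P).mpr ⟨LinearEquiv.refl _ _⟩
  -- `e` read on `V`
  obtain ⟨g, hg⟩ : ∃ g : V ≃ₗ[ℝ] V, ∀ x : V, g x = (e (ULift.up x)).down :=
    ⟨(mV.symm.trans (e.restrictScalars ℝ)).trans mV, fun x => by
      show mV (e.restrictScalars ℝ (mV.symm x)) = _
      rw [hmVs, LinearEquiv.restrictScalars_apply, hmV]⟩
  -- «there exists `c ∈ C^×` such that `h′ = Int(c) ∘ h`»: `g` commutes with `ρ(B)` and with `h(ℂ)`
  have hgρ : ∀ (b : B) (x : V), g (ρ b x) = ρ b (g x) := fun b x => by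
    have h0 := e.map_smul (ULift.up b ⊗ₜ[ℝ] (1 : ULift.{max u v} ℂ)) (ULift.up x)
    rw [hsm, hsm] at h0
    simp only [ULift.one_down, map_one, Module.End.one_apply] at h0
    rw [hg, hg, h0]
  have hgh : ∀ (z : ℂ) (x : V), g (η.h z x) = η.h z (g x) := fun z x => by
    have h0 := e.map_smul ((1 : ULift.{v} B) ⊗ₜ[ℝ] ULift.up z) (ULift.up x)
    rw [hsm, hsm] at h0
    simp only [ULift.one_down, map_one, Module.End.one_apply] at h0
    rw [hg, hg, h0]
  have hII : ∀ x : V, η.h Complex.I (η.h Complex.I x) = -x := fun x => by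
    rw [← Module.End.mul_apply, ← map_mul, Complex.I_mul_I, map_neg, map_one]
    rfl
  have hII' : ∀ x : V, η'.h Complex.I (η'.h Complex.I x) = -x := fun x => by
    rw [← Module.End.mul_apply, ← map_mul, Complex.I_mul_I, map_neg, map_one]
    rfl
  /- `c = f ∘ g` -/
  refine ⟨g.trans f, fun b x => ?_, fun z x => ?_, fun x y => ?_⟩
  · rw [LinearEquiv.trans_apply, hgρ, hfρ, LinearEquiv.trans_apply]
  · rw [LinearEquiv.trans_apply, hgh, hfh, LinearEquiv.trans_apply]
  · /- «`⟨v, h(i)w⟩ = ⟨cv, h′(i)cw⟩′` … It follows that `⟨v, w⟩ = ⟨cv, cw⟩′» (substitute `w ↦ −h(i)w`) -/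
    rw [LinearEquiv.trans_apply, LinearEquiv.trans_apply]
    have key := he (ULift.up x) (ULift.up (-(η.h Complex.I y)))
    rw [hΦ', hΦ] at key
    rw [← hg, ← hg, map_neg g, map_neg f, hgh, hfh, map_neg (η'.h Complex.I), hII', neg_neg,
      map_neg (η.h Complex.I), hII, neg_neg] at key
    exact key

end Literature.NumberTheory.Kottwitz1992.HermitianSymmetricSpaces

end
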